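import Mathlib
import HarnessLib
import Summits.HubbardSuperconductivity.HubbardSuperconductivity.Theorems.KLProgrammeKLRegimeTwoPointAssemblyFree
import Summits.HubbardSuperconductivity.HubbardSuperconductivity.Theorems.KLProgrammeKLRegimeVolumeLimitDefs
import Literature.MathematicalPhysics.QuantumLattice.FejerTopCutoff

/-!
# Child 4 `KLRegimeTwoPointAssemblyV7` (stmt-HubbardSuperconductivity-19666), stub `stub_asm_int` — part 1, TOOLS: Matsubara
# integers, the continuum frame propagator `g_n(p)` with `|g_n|² ≤ ω_n⁻²`, and `Σ_{n∈ℤ} 1/(2n+1)² < ∞` (seat hubbard-kl-r2d-p2)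

`reprInt L M = Σ_n a_{L,M}(n)`, `a_{L,M}(n) = (1/β) L⁻² Σ_{k⃗} e^{ip(x̄−ȳ)} ĝ_K(ω_n,k⃗)² Σ̂_{L,M}((ω_n,k⃗),σ)` over the Matsubara integers `n ∈ [−M, M)`.
Domination: `|ĝ_K(ω,k⃗)|² ≤ ω⁻² = β²/(π²(2n+1)²)` and `‖Σ̂‖ ≤ B` beyond `(L₀, Mstar)` (VL (i)) give a summable majorant; per `n`,
`a_{L,M}(n)` is within `(β/π²)ε'` of the Riemann sum of the CONTINUOUS `p ↦ e^{ip(x−y)} ĝ_n(p)² Σ∞(n,p,σ)` (VL (ii)), whose Riemann sums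
converge (`tendsto_cornerRiemannSum`); the iterated-Cauchy Tannery lemma (`…IteratedCauchy`) assembles.
-/

noncomputable section

namespace Summit.HubbardSuperconductivity.HubbardSuperconductivity.Theorems.TwoPointAssembly

set_option linter.dupNamespace false -- summit = problem name (single-conjunct summit), D-0017

open Finset Filter Topology MeasureTheory Literature.MathematicalPhysics.QuantumLattice Literature.Probability.LatticeModels
open GrassmannAlgebra Summit.HubbardSuperconductivity.HubbardSuperconductivity.Theorems.KLRegimeSplit
open Summit.HubbardSuperconductivity.HubbardSuperconductivity.Theorems.KLProgrammeLegKernels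

/-! ## §1 Matsubara integers and the propagator bound -/

/-- The frequency label of the Matsubara integer `n ∈ [−M, M)`. -/
def idxOfInt (M : ℕ) (n : ℤ) (h : -(M : ℤ) ≤ n ∧ n < M) : MatsubaraIdx M :=
  ⟨(n + M).toNat, by omega⟩

/-- Its integer is `n`. -/
theorem matsubaraInt_idxOfInt (M : ℕ) (n : ℤ) (h : -(M : ℤ) ≤ n ∧ n < M) : matsubaraInt M (idxOfInt M n h) = n := by
  simp only [matsubaraInt, idxOfInt]
  omega

/-- The integer of a label lies in `[−M, M)`. -/
theorem matsubaraInt_mem (M : ℕ) (ω : MatsubaraIdx M) : -(M : ℤ) ≤ matsubaraInt M ω ∧ matsubaraInt M ω < M := by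
  have := ω.isLt
  simp only [matsubaraInt]
  omega

/-- `idxOfInt` inverts `matsubaraInt`. -/
theorem idxOfInt_matsubaraInt (M : ℕ) (ω : MatsubaraIdx M) :
    idxOfInt M (matsubaraInt M ω) (matsubaraInt_mem M ω) = ω := by
  apply Fin.ext
  simp only [idxOfInt, matsubaraInt]
  omega

/-- The Matsubara frequency of the integer `n`: `ω_n = π(2n+1)/β`. -/
def freqOfInt (β : ℝ) (n : ℤ) : ℝ := Real.pi * (2 * (n : ℝ) + 1) / β

/-- The frequency of a label is the frequency of its integer. -/
theorem matsubaraFreq_eq_freqOfInt (β : ℝ) (M : ℕ) (ω : MatsubaraIdx M) :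
    matsubaraFreq β M ω = freqOfInt β (matsubaraInt M ω) := rfl

/-- `ω_n ≠ 0` (for `β ≠ 0`). -/
theorem freqOfInt_ne_zero {β : ℝ} (hβ : β ≠ 0) (n : ℤ) : freqOfInt β n ≠ 0 := by
  unfold freqOfInt
  have h1 : (2 * (n : ℝ) + 1) ≠ 0 := by
    intro h
    have : (2 * n + 1 : ℤ) = 0 := by exact_mod_cast h
    omega
  exact div_ne_zero (mul_ne_zero Real.pi_ne_zero h1) hβ

/-- The continuum frame propagator at the Matsubara integer `n`: `g_n(p) = 1/(−iω_n + e_K(p))`. -/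
def propInt (β μ : ℝ) (K : TrigPolyC4v) (n : ℤ) (p : Fin 2 → ℝ) : ℂ :=
  1 / (-Complex.I * (freqOfInt β n : ℂ) + (bandCT μ K p : ℂ))

/-- The denominator never vanishes. -/
theorem propInt_den_ne_zero {β : ℝ} (hβ : β ≠ 0) (μ : ℝ) (K : TrigPolyC4v) (n : ℤ) (p : Fin 2 → ℝ) :
    (-Complex.I * (freqOfInt β n : ℂ) + (bandCT μ K p : ℂ)) ≠ 0 := by
  intro h
  have := congrArg Complex.im h
  simp at this
  exact freqOfInt_ne_zero hβ n this

/-- `|1/(−iω + e)| ≤ 1/|ω|`. -/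
theorem norm_one_div_le {ω : ℝ} (hω : ω ≠ 0) (e : ℝ) : ‖(1 : ℂ) / (-Complex.I * (ω : ℂ) + (e : ℂ))‖ ≤ 1 / |ω| := by
  rw [norm_div, norm_one]
  apply one_div_le_one_div_of_le (abs_pos.2 hω)
  have him : ((-Complex.I * (ω : ℂ) + (e : ℂ))).im = -ω := by simp
  calc |ω| = |((-Complex.I * (ω : ℂ) + (e : ℂ))).im| := by rw [him, abs_neg]
    _ ≤ ‖-Complex.I * (ω : ℂ) + (e : ℂ)‖ := Complex.abs_im_le_norm _

/-- The torus propagator is the continuum one at the lattice momentum. -/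
theorem propCT_eq_propInt {L : ℕ} [NeZero L] (M : ℕ) (β μ : ℝ) (K : TrigPolyC4v) (ω : MatsubaraIdx M) (k : TorusSite 2 L) :
    propCT L M β μ K (ω, k) = propInt β μ K (matsubaraInt M ω) (latticeMomentum L k) := by
  rw [propCT, propInt, matsubaraFreq_eq_freqOfInt, nambuXiCT_eq_bandCT]

/-- `‖g_n(p)‖² ≤ β²/(π²(2n+1)²)`. -/
theorem norm_propInt_sq_le {β : ℝ} (hβ : β ≠ 0) (μ : ℝ) (K : TrigPolyC4v) (n : ℤ) (p : Fin 2 → ℝ) :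
    ‖propInt β μ K n p‖ ^ 2 ≤ (1 / |freqOfInt β n|) ^ 2 := by
  have h := norm_one_div_le (freqOfInt_ne_zero hβ n) (bandCT μ K p)
  rw [propInt]
  exact pow_le_pow_left₀ (norm_nonneg _) h 2

/-- Continuity of the continuum propagator in the momentum. -/
theorem continuous_propInt {β : ℝ} (hβ : β ≠ 0) (μ : ℝ) (K : TrigPolyC4v) (n : ℤ) : Continuous (propInt β μ K n) := by
  unfold propInt
  refine continuous_const.div (continuous_const.add (Complex.continuous_ofReal.comp (continuous_bandCT μ K)))
    (propInt_den_ne_zero hβ μ K n)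

/-! ## §2 Summability of the majorant `1/(2n+1)²` over `ℤ` -/

/-- `Σ_{n ∈ ℤ} 1/(2n+1)²` converges. -/
theorem summable_one_div_two_mul_add_one_sq : Summable fun n : ℤ => 1 / (2 * (n : ℝ) + 1) ^ 2 := by
  have hnat : Summable fun n : ℕ => 4 * (1 / ((n : ℝ) + 1) ^ 2) := by
    have h := (summable_nat_add_iff 1).2 (Real.summable_one_div_nat_pow.2 one_lt_two)
    simp only [Nat.cast_add, Nat.cast_one] at h
    exact h.mul_left 4
  refine summable_int_iff_summable_nat_and_neg.2 ⟨?_, ?_⟩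
  · refine Summable.of_nonneg_of_le (fun n => by positivity) (fun n => ?_) hnat
    push_cast
    have hpos : (0 : ℝ) < ((n : ℝ) + 1) ^ 2 := by positivity
    rw [div_le_iff₀ (by positivity), mul_one_div, div_mul_eq_mul_div, le_div_iff₀ hpos, one_mul]
    have hn : (0 : ℝ) ≤ n := Nat.cast_nonneg n
    nlinarith
  · refine Summable.of_nonneg_of_le (fun n => by positivity) (fun n => ?_) hnat
    push_cast
    have hne : (2 * -(n : ℝ) + 1) ^ 2 ≠ 0 := by
      intro h
      have h' : (2 * -(n : ℝ) + 1) = 0 := pow_eq_zero_iff (n := 2) (by norm_num) |>.1 h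
      have : (2 * -(n : ℤ) + 1) = 0 := by exact_mod_cast h'
      omega
    have hpos' : (0 : ℝ) < ((n : ℝ) + 1) ^ 2 := by positivity
    rw [div_le_iff₀ (lt_of_le_of_ne (sq_nonneg _) (Ne.symm hne)), mul_one_div, div_mul_eq_mul_div, le_div_iff₀ hpos', one_mul]
    rcases Nat.eq_zero_or_pos n with h0 | hpos
    · subst h0; norm_num
    · have h1 : (1 : ℝ) ≤ n := by exact_mod_cast hpos
      nlinarith

end Summit.HubbardSuperconductivity.HubbardSuperconductivity.Theorems.TwoPointAssembly

end
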